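import Summits.CriticalPhenomena.PercolationContinuityZ3.Theorems.SahiMasterFamilyE3FCovariance
import Summits.CriticalPhenomena.PercolationContinuityZ3.Theorems.SahiMasterFamilyFibreCubic
import HarnessLib

/-!
# The one-coordinate recursion for `E_3` when the third event is free of the coordinate

Unit `prim-master-conj` (crux anchor stmt-CriticalPhenomena-4575, helper work), gen 38; memo
`run/shared/lean/prim/prim-l12/prim-master-conj/POINTWISE.md` §39 and
`run/shared/lean/prim/prim-l12/FROM-prim-master-conj-g38-TRIANGLE-RECURSION.md`.

Write `μ⟦X⟧ = E(1_X)` under the product weight `μ_p`, `X⁰, X¹` for the `e`-sections of an event and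
`Φ(s) = E_3(μ_{p[e↦s]}; 1_{U₀}, 1_{U₁}, 1_{U₂})` for the fibre cubic (`cubicE3`).  If the third event `U₂` does not
depend on the coordinate `e` (`U₂⁰ = U₂¹ = U₂`) then `Φ` is a QUADRATIC and

  `Φ(s) = (1−s)·Φ(0) + s·Φ(1) − s(1−s)·𝒞`,
  `𝒞 := μ⟦U₂⟧·δ·ε − δ·(μ⟦U₁¹∩U₂⟧ − μ⟦U₁⁰∩U₂⟧) − ε·(μ⟦U₀¹∩U₂⟧ − μ⟦U₀⁰∩U₂⟧)`, `δ = μ⟦U₀¹⟧ − μ⟦U₀⁰⟧`, `ε = μ⟦U₁¹⟧ − μ⟦U₁⁰⟧`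

(`cubicE3_eq_of_third_free`; exact, every `U₀, U₁`, no independence hypothesis: the mixed moment `μ⟦U₀∩U₁⟧`
enters `Φ` linearly and cancels).  Hence (`sahiE_three_nonneg_of_third_free`): if both `e`-minors have `E_3 ≥ 0` and the
GENERALISED TWO-RECTANGLE INEQUALITY `Φ(0) + Φ(1) ≥ 𝒞` holds, then `E_3(μ_p; U) ≥ 0`, because
`Φ(s) = (1−s)²Φ(0) + s²Φ(1) + s(1−s)(Φ(0) + Φ(1) − 𝒞)`.  For `U₀ = a × ·`, `U₁ = b × ·` with independent sections this
is exactly how `MixedRectangle.twoRectangle_nonneg` (`T_mix ≥ 0`, the case where `Φ(0), Φ(1)` are the two-Harris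
quantities `D`) gives `C₃` for pair-overlap `≤ 1` (gen 37).  The recursion is the induction scheme for the
"triangle-graphical" family `f(x,y), g(x,z), h(y,z)` (no coordinate common to all three supports): Sahi's `C₃` there
follows from the inequality `Φ(0) + Φ(1) ≥ 𝒞` for nested pairs of such triples (memo: conjecture (GT'), census-clean,
equal to `T_mix ≥ 0` in the base case and implied by the orbit-sum inequalities (Ψ_d)).
HONEST FRAMING: an identity and a conditional reduction; Kahn's Conjecture 5 / Sahi's `C₃` remain OPEN. [this work]
-/

noncomputable section

open scoped Classical

namespace Summit.CriticalPhenomena.PercolationContinuityZ3.Theorems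

namespace ThirdFreeRecursion

open Finset Function
open Literature.Combinatorics.Sahi2008
open Literature.Probability.Percolation.DecisionTree (ind ind_nonneg ind_of_mem ind_of_not_mem)

variable {ι : Type} [Fintype ι]

local notation3 (prettyPrint := false) "μ⟦" q ", " X "⟧" => ex (bernoulliWeight q) (ind X)

/-- The section moment of an indicator is the expectation of the section's indicator (as in
`MixedRectangle.secEx_ind_eq`, restated to keep this file independent of that module's build). [this work] -/
private theorem secEx_ind_eq' (p : ι → unitInterval) (e : ι) (A : Set (Set ι)) (b : Bool) :
    secEx p e (ind A) b = μ⟦p, secAt e b A⟧ := by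
  have h1 : secEx p e (ind A) b = ex (bernoulliWeight (update p e (boolParam b))) (ind A) := by
    rw [ex_update_eq]
    cases b <;> simp [boolParam]
  rw [h1, ex_ind_update_boolParam, ex_update_eq_of_ignores p e (boolParam b) (p e) (ind_secAt_insert e b A),
    update_eq_self]

/-- `E(1_X) ≤ E(1_Y)` for `X ⊆ Y` under a nonnegative weight. [folklore] -/
private theorem ex_ind_mono' {μ : Set ι → ℝ} (hμ : ∀ ω, 0 ≤ μ ω) {X Y : Set (Set ι)} (h : X ⊆ Y) :
    ex μ (ind X) ≤ ex μ (ind Y) := by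
  refine ex_mono hμ fun ω => ?_
  by_cases hX : ω ∈ X
  · rw [ind_of_mem hX, ind_of_mem (h hX)]
  · rw [ind_of_not_mem hX]; exact ind_nonneg Y ω

/-- **The fibre cubic is a quadratic with an explicit defect when the third event is free of `e`.**  For events
`U₀, U₁, U₂` with `U₂⁰ = U₂¹ = U₂` (sections at `e`) and every real `s`:
`Φ(s) = (1−s)Φ(0) + sΦ(1) − s(1−s)·[μ⟦U₂⟧δε − δ(μ⟦U₁¹∩U₂⟧ − μ⟦U₁⁰∩U₂⟧) − ε(μ⟦U₀¹∩U₂⟧ − μ⟦U₀⁰∩U₂⟧)]`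
with `δ = μ⟦U₀¹⟧ − μ⟦U₀⁰⟧`, `ε = μ⟦U₁¹⟧ − μ⟦U₁⁰⟧`. [this work] -/
theorem cubicE3_eq_of_third_free (p : ι → unitInterval) (e : ι) (U : Fin 3 → Set (Set ι))
    (hfree : ∀ b : Bool, secAt e b (U 2) = U 2) (s : ℝ) :
    cubicE3 p e (ind (U 0)) (ind (U 1)) (ind (U 2)) s =
      (1 - s) * cubicE3 p e (ind (U 0)) (ind (U 1)) (ind (U 2)) 0
        + s * cubicE3 p e (ind (U 0)) (ind (U 1)) (ind (U 2)) 1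
        - s * (1 - s) *
          (μ⟦p, U 2⟧ * (μ⟦p, secAt e true (U 0)⟧ - μ⟦p, secAt e false (U 0)⟧)
              * (μ⟦p, secAt e true (U 1)⟧ - μ⟦p, secAt e false (U 1)⟧)
            - (μ⟦p, secAt e true (U 0)⟧ - μ⟦p, secAt e false (U 0)⟧)
              * (μ⟦p, secAt e true (U 1) ∩ U 2⟧ - μ⟦p, secAt e false (U 1) ∩ U 2⟧)
            - (μ⟦p, secAt e true (U 1)⟧ - μ⟦p, secAt e false (U 1)⟧)
              * (μ⟦p, secAt e true (U 0) ∩ U 2⟧ - μ⟦p, secAt e false (U 0) ∩ U 2⟧)) := by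
  have hprod : ∀ (A B : Set (Set ι)), ind A * ind B = ind (A ∩ B) := fun A B => ind_mul_ind_eq_inter A B
  simp only [cubicE3, hprod, secEx_ind_eq', secAt_inter, hfree]
  ring

/-- The Bernstein form of the quadratic: `Φ(s) = (1−s)²Φ(0) + s²Φ(1) + s(1−s)·(Φ(0) + Φ(1) − 𝒞)`. [this work] -/
theorem cubicE3_eq_bernstein_of_third_free (p : ι → unitInterval) (e : ι) (U : Fin 3 → Set (Set ι))
    (hfree : ∀ b : Bool, secAt e b (U 2) = U 2) (s : ℝ) :
    cubicE3 p e (ind (U 0)) (ind (U 1)) (ind (U 2)) s =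
      (1 - s) ^ 2 * cubicE3 p e (ind (U 0)) (ind (U 1)) (ind (U 2)) 0
        + s ^ 2 * cubicE3 p e (ind (U 0)) (ind (U 1)) (ind (U 2)) 1
        + s * (1 - s) *
          (cubicE3 p e (ind (U 0)) (ind (U 1)) (ind (U 2)) 0 + cubicE3 p e (ind (U 0)) (ind (U 1)) (ind (U 2)) 1
            - (μ⟦p, U 2⟧ * (μ⟦p, secAt e true (U 0)⟧ - μ⟦p, secAt e false (U 0)⟧)
                  * (μ⟦p, secAt e true (U 1)⟧ - μ⟦p, secAt e false (U 1)⟧)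
                - (μ⟦p, secAt e true (U 0)⟧ - μ⟦p, secAt e false (U 0)⟧)
                  * (μ⟦p, secAt e true (U 1) ∩ U 2⟧ - μ⟦p, secAt e false (U 1) ∩ U 2⟧)
                - (μ⟦p, secAt e true (U 1)⟧ - μ⟦p, secAt e false (U 1)⟧)
                  * (μ⟦p, secAt e true (U 0) ∩ U 2⟧ - μ⟦p, secAt e false (U 0) ∩ U 2⟧))) := by
  rw [cubicE3_eq_of_third_free p e U hfree s]
  ring

/-- **`E_3 ≥ 0` BY THE ONE-COORDINATE RECURSION (third event free of `e`).**  Let `U₀, U₁, U₂` be events with `U₂`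
free of `e`.  If both `e`-minors have `E_3(μ_p) ≥ 0` and the generalised two-rectangle inequality
`E_3(μ_p; U⁰) + E_3(μ_p; U¹) ≥ μ⟦U₂⟧δε − δ(μ⟦U₁¹∩U₂⟧ − μ⟦U₁⁰∩U₂⟧) − ε(μ⟦U₀¹∩U₂⟧ − μ⟦U₀⁰∩U₂⟧)` holds, then
`E_3(μ_p; 1_{U₀},1_{U₁},1_{U₂}) ≥ 0`.  (Base case of the scheme: `U₀, U₁` with independent `e`-sections, where the two
minors are two-Harris quantities and the inequality is `MixedRectangle.twoRectangle_nonneg`.) [this work] -/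
theorem sahiE_three_nonneg_of_third_free (p : ι → unitInterval) (e : ι) {U : Fin 3 → Set (Set ι)}
    (hfree : ∀ b : Bool, secAt e b (U 2) = U 2)
    (h0 : 0 ≤ sahiE (bernoulliWeight p) 3 (fun j => ind (secAt e false (U j))))
    (h1 : 0 ≤ sahiE (bernoulliWeight p) 3 (fun j => ind (secAt e true (U j))))
    (hGT : μ⟦p, U 2⟧ * (μ⟦p, secAt e true (U 0)⟧ - μ⟦p, secAt e false (U 0)⟧)
              * (μ⟦p, secAt e true (U 1)⟧ - μ⟦p, secAt e false (U 1)⟧)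
            - (μ⟦p, secAt e true (U 0)⟧ - μ⟦p, secAt e false (U 0)⟧)
              * (μ⟦p, secAt e true (U 1) ∩ U 2⟧ - μ⟦p, secAt e false (U 1) ∩ U 2⟧)
            - (μ⟦p, secAt e true (U 1)⟧ - μ⟦p, secAt e false (U 1)⟧)
              * (μ⟦p, secAt e true (U 0) ∩ U 2⟧ - μ⟦p, secAt e false (U 0) ∩ U 2⟧)
          ≤ sahiE (bernoulliWeight p) 3 (fun j => ind (secAt e false (U j)))
            + sahiE (bernoulliWeight p) 3 (fun j => ind (secAt e true (U j)))) :
    0 ≤ sahiE (bernoulliWeight p) 3 (fun j => ind (U j)) := by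
  have hE : sahiE (bernoulliWeight p) 3 (fun j => ind (U j)) =
      cubicE3 p e (ind (U 0)) (ind (U 1)) (ind (U 2)) ((p e : unitInterval) : ℝ) := by
    have h := SahiLogDerivEnd.sahiE_three_ind_update_eq p e (p e) U
    rwa [update_eq_self] at h
  rw [hE, cubicE3_eq_bernstein_of_third_free p e U hfree, SahiLogDerivEnd.cubicE3_zero_eq_secAt,
    FibreCubic.cubicE3_one_eq_secAt]
  have hs0 : 0 ≤ ((p e : unitInterval) : ℝ) := (p e).2.1
  have hs1 : ((p e : unitInterval) : ℝ) ≤ 1 := (p e).2.2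
  have c0 := mul_nonneg (pow_nonneg (sub_nonneg.2 hs1) 2) h0
  have c1 := mul_nonneg (pow_nonneg hs0 2) h1
  have c2 := mul_nonneg (mul_nonneg hs0 (sub_nonneg.2 hs1)) (sub_nonneg.2 hGT)
  linarith

/-- **The defect vanishes in mean over `U₂ = Ω`:** with `U₂` the sure event the generalised two-rectangle inequality
reads `E_3(U⁰) + E_3(U¹) ≥ −δε`, i.e. it is implied by the minors alone up to the slack `δε ≥ 0` — recorded as the
sanity check `𝒞 = −δε ≤ 0` for `U₂ = univ`. [this work] -/
theorem defect_univ_nonpos (p : ι → unitInterval) (e : ι) (U₀ U₁ : Set (Set ι)) (hU₀ : IsUpperSet U₀)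
    (hU₁ : IsUpperSet U₁) :
    μ⟦p, (Set.univ : Set (Set ι))⟧ * (μ⟦p, secAt e true U₀⟧ - μ⟦p, secAt e false U₀⟧)
          * (μ⟦p, secAt e true U₁⟧ - μ⟦p, secAt e false U₁⟧)
        - (μ⟦p, secAt e true U₀⟧ - μ⟦p, secAt e false U₀⟧)
          * (μ⟦p, secAt e true U₁ ∩ Set.univ⟧ - μ⟦p, secAt e false U₁ ∩ Set.univ⟧)
        - (μ⟦p, secAt e true U₁⟧ - μ⟦p, secAt e false U₁⟧)
          * (μ⟦p, secAt e true U₀ ∩ Set.univ⟧ - μ⟦p, secAt e false U₀ ∩ Set.univ⟧) ≤ 0 := by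
  have hμ := (isFKGMeasure_bernoulliWeight p).nonneg
  have h1 : μ⟦p, (Set.univ : Set (Set ι))⟧ = 1 := by
    rw [ex_bernoulliWeight_ind]; simp
  simp only [Set.inter_univ, h1, one_mul]
  have hδ : 0 ≤ μ⟦p, secAt e true U₀⟧ - μ⟦p, secAt e false U₀⟧ :=
    sub_nonneg.2 (ex_ind_mono' hμ (secAt_false_subset_true hU₀ e))
  have hε : 0 ≤ μ⟦p, secAt e true U₁⟧ - μ⟦p, secAt e false U₁⟧ :=
    sub_nonneg.2 (ex_ind_mono' hμ (secAt_false_subset_true hU₁ e))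
  nlinarith [mul_nonneg hδ hε]

end ThirdFreeRecursion

end Summit.CriticalPhenomena.PercolationContinuityZ3.Theorems
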